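import Mathlib
import HarnessLib
import Summits.QuantumFields.QCD.Theses.AdaptiveBlockFermions

/-!
Sketch for crux-ideate stmt-QuantumFields-9494 (AdaptiveCoarseSystem), ideator 1, round 1.
First lemmas of the three idea cards; statements only (sorried), they must ELABORATE.
-/

namespace Summit.QuantumFields.QCD.Cruxes.AdaptiveCoarseSystem.Sketch

open Matrix
open Literature.MathematicalPhysics.QuantumLattice
open Literature.MathematicalPhysics.QuantumFieldTheory
open Literature.Probability.LatticeModels

/-! ### Card 1 `chiral-lichnerowicz-square` — first lemma: the γ₅-parity splitting of the square. -/

/-- (L1a) For the Wilson–Dirac operator `D` and `Γ = 1 ⊗ 1 ⊗ γ₅`: the symmetrised square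
`T = Dᴴ D + D Dᴴ` commutes with `Γ` (chirality-even) and the normality defect
`X = Dᴴ D − D Dᴴ` anticommutes with `Γ` (chirality-odd). Consequence of γ₅-hermiticity
`Γ D Γ = Dᴴ` (`wilsonDirac_gammaFive_hermitian_holds`) and `Γ² = 1`. -/
theorem chiralSquare_parity (L : ℕ) [NeZero L]
    (U : GaugeConfig 4 L (Matrix.specialUnitaryGroup (Fin 3) ℂ)) (m : ℝ) :
    let D := wilsonDirac (fundamentalRep (Fin 3)) U m 1
    let Γ := spinorLift (L := L) (N := 3) gammaFive
    Γ * (Dᴴ * D + D * Dᴴ) = (Dᴴ * D + D * Dᴴ) * Γ ∧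
      Γ * (Dᴴ * D - D * Dᴴ) = -((Dᴴ * D - D * Dᴴ) * Γ) := by
  sorry

/-- (L1b) The energy identity `‖D w‖² + ‖Dᴴ w‖² = Re ⟨w, (DᴴD + DDᴴ) w⟩`: `T`-smallness on a
span is exactly simultaneous `D`- and `Dᴴ`-smoothness (clause (e) for chiral generators). -/
theorem chiralSquare_energy (L : ℕ) [NeZero L]
    (U : GaugeConfig 4 L (Matrix.specialUnitaryGroup (Fin 3) ℂ)) (m : ℝ)
    (w : (TorusSite 4 L × Fin 3 × Fin 4) → ℂ) :
    let D := wilsonDirac (fundamentalRep (Fin 3)) U m 1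
    (star (D *ᵥ w) ⬝ᵥ (D *ᵥ w)).re + (star (Dᴴ *ᵥ w) ⬝ᵥ (Dᴴ *ᵥ w)).re =
      (star w ⬝ᵥ ((Dᴴ * D + D * Dᴴ) *ᵥ w)).re := by
  sorry

/-- (L1c) Curvature bound on the normality defect: `X = DᴴD − DDᴴ = 2[W, N]` is a range-2
operator built from plaquette holonomies; in particular it VANISHES on flat configurations
(all plaquette holonomies trivial), where `D` is normal. Stated here in the flat case only. -/
theorem normalityDefect_eq_zero_of_flat (L : ℕ) [NeZero L]
    (U : GaugeConfig 4 L (Matrix.specialUnitaryGroup (Fin 3) ℂ)) (m : ℝ)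
    (hflat : ∀ (x : TorusSite 4 L) (i j : Fin 4), plaquetteHolonomy U x i j = 1) :
    let D := wilsonDirac (fundamentalRep (Fin 3)) U m 1
    Dᴴ * D = D * Dᴴ := by
  sorry

/-- (Sub-crux named by card 1) **Window quasinormality** `NC`: inside the resolution window,
every `ε/b`-approximate null vector of `D_W` has a fixed-fraction overlap with a DOUBLY smooth
vector (small for `D` and `Dᴴ` at rate `1/b`). Shown NECESSARY for `AdaptiveCoarseSystem` in the
card (refuter's overlap bound + `IsAdaptiveCoarseSystem.conjTranspose_smooth`). -/
def WindowQuasinormality : Prop :=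
  ∀ Cs : ℝ, 0 < Cs → ∃ ε θ cres : ℝ, 0 < ε ∧ 0 < θ ∧ 0 < cres ∧
    ∀ (L b : ℕ) [NeZero L], 2 ≤ b →
    ∀ (U : GaugeConfig 4 L (Matrix.specialUnitaryGroup (Fin 3) ℂ)) (m : ℝ),
      -(cres / (b : ℝ) ^ 2) ≤ m → m ≤ 1 →
      let D := wilsonDirac (fundamentalRep (Fin 3)) U m 1
      ∀ ψ : (TorusSite 4 L × Fin 3 × Fin 4) → ℂ,
        (b : ℝ) ^ 2 * (star (D *ᵥ ψ) ⬝ᵥ (D *ᵥ ψ)).re ≤ ε ^ 2 * (star ψ ⬝ᵥ ψ).re →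
        ∃ w : (TorusSite 4 L × Fin 3 × Fin 4) → ℂ,
          (b : ℝ) ^ 2 * (star (D *ᵥ w) ⬝ᵥ (D *ᵥ w)).re ≤ Cs ^ 2 * (star w ⬝ᵥ w).re ∧
          (b : ℝ) ^ 2 * (star (Dᴴ *ᵥ w) ⬝ᵥ (Dᴴ *ᵥ w)).re ≤ Cs ^ 2 * (star w ⬝ᵥ w).re ∧
          θ ^ 2 * (star ψ ⬝ᵥ ψ).re * (star w ⬝ᵥ w).re ≤ ‖star w ⬝ᵥ ψ‖ ^ 2

/-! ### Card 2 `normal-dressing` — first lemma: containment ⇒ inf–sup for NORMAL operators. -/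

/-- (L2) Abstract finite-dimensional lemma ("containment + near-invariance ⇒ inf–sup").
`D` any matrix, `E` an orthogonal projection commuting with `D` (for a NORMAL `D`: a spectral
projection `1_{|D| ≤ Λ}`, which then also commutes with `Dᴴ` and, for γ₅-hermitian `D`, with
`Γ`), `D` coercive off `range E` (`‖D (1-E) v‖ ≥ Λ ‖(1-E) v‖`); if the coarse generators capture
`range E` up to relative error `δ` (containment, the GenEO/LOD output) and their span is
`Dᴴ`-invariant up to an ABSOLUTE defect `η` (for normal `D`, `Dᴴ` preserves every spectral class,
so `η` is only the partition-of-unity commutator `‖[Dᴴ, χ]‖ ~ C_∇/b`, independent of the capture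
threshold `Λ ~ c₀/b`), then the compression of `D` to `gens^⊥` is inf–sup stable with constant
`Λ(1-δ) - η` — positive once the capture threshold dominates the cutoff leak. This is clause (g),
the one the refuters showed independent of (b),(e),(f), obtained from containment for (near-)normal
operators. -/
theorem infSup_of_containment_of_commuting_projection {ι : Type} [Fintype ι] [DecidableEq ι]
    (D E : Matrix ι ι ℂ) (gens : Finset (ι → ℂ)) (Λ δ η : ℝ) (hΛ : 0 ≤ Λ) (hδ : 0 ≤ δ) (hη : 0 ≤ η)
    (hEE : E * E = E) (hEh : Eᴴ = E) (hED : E * D = D * E)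
    (hhigh : ∀ v, Λ ^ 2 * (star ((1 - E) *ᵥ v) ⬝ᵥ ((1 - E) *ᵥ v)).re ≤
      (star (D *ᵥ ((1 - E) *ᵥ v)) ⬝ᵥ (D *ᵥ ((1 - E) *ᵥ v))).re)
    (hcont : ∀ v, ∃ w ∈ Submodule.span ℂ (↑gens : Set (ι → ℂ)),
      (star (E *ᵥ v - w) ⬝ᵥ (E *ᵥ v - w)).re ≤ δ ^ 2 * (star (E *ᵥ v) ⬝ᵥ (E *ᵥ v)).re)
    (hinv : ∀ w ∈ Submodule.span ℂ (↑gens : Set (ι → ℂ)), ∃ w' ∈ Submodule.span ℂ (↑gens : Set (ι → ℂ)),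
      (star (Dᴴ *ᵥ w - w') ⬝ᵥ (Dᴴ *ᵥ w - w')).re ≤ η ^ 2 * (star w ⬝ᵥ w).re) :
    ∀ u, (∀ g ∈ gens, star g ⬝ᵥ u = 0) → ∃ v, (∀ g ∈ gens, star g ⬝ᵥ v = 0) ∧
      (star v ⬝ᵥ v).re ≤ 1 ∧
        (Λ * (1 - δ) - η) * Real.sqrt ((star u ⬝ᵥ u).re) ≤ (star v ⬝ᵥ (D *ᵥ u)).re := by
  sorry

/-! ### Card 3 `wilson-curvature-coercivity` — first lemma: the Wilson curvature inequality. -/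

/-- (L3) **Wilson curvature inequality**: the felt plaquette curvature of any lattice spinor is
controlled by its Wilson (real-part) energy,
`Σ_x Σ_{i<j} ‖(1 − ρ(U_P(x,i,j))) φ(x,·,s)‖² ≤ 48 (Re⟨φ, D_W φ⟩ − m ‖φ‖²)`, because
`Re D_W = m + W`, `⟨φ, W φ⟩ = ½ Σ_μ ‖(1 − S_μ)φ‖²` and `1 − S_iS_jS_iᴴS_jᴴ` telescopes into four
covariant differences (`S_iS_jS_iᴴS_jᴴ` acts as the tree's `plaquetteHolonomy U x i j` on the
fibre at `x`). Hence regions of felt curvature `≥ ε₀` carry `Re D_W ≥ m + ε₀²/48`: the Wilson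
term turns curvature into a local real-part mass gap (rough pockets host no window low modes and
can be Schur-eliminated). -/
theorem wilson_curvature_le_realPart (L : ℕ) [NeZero L]
    (U : GaugeConfig 4 L (Matrix.specialUnitaryGroup (Fin 3) ℂ)) (m : ℝ)
    (φ : (TorusSite 4 L × Fin 3 × Fin 4) → ℂ) :
    let D := wilsonDirac (fundamentalRep (Fin 3)) U m 1
    (∑ x : TorusSite 4 L, ∑ i : Fin 4, ∑ j : Fin 4, ∑ s : Fin 4, if i < j then
        ∑ a : Fin 3, ‖((1 - fundamentalRep (Fin 3) (plaquetteHolonomy U x i j)) *ᵥ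
          (fun c : Fin 3 => φ (x, c, s))) a‖ ^ 2 else 0) ≤
      48 * ((star φ ⬝ᵥ (D *ᵥ φ)).re - m * (star φ ⬝ᵥ φ).re) := by
  sorry

/-- (L3') Consequence used by the Schur elimination: on vectors supported where EVERY site feels
curvature at least `ε₀` in some plaquette direction for every colour component, the real part of
`D_W` is coercive: `Re⟨φ, Dφ⟩ ≥ (m + ε₀²/48) ‖φ‖²`. -/
theorem realPart_coercive_of_rough_support (L : ℕ) [NeZero L]
    (U : GaugeConfig 4 L (Matrix.specialUnitaryGroup (Fin 3) ℂ)) (m ε₀ : ℝ)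
    (R : Set (TorusSite 4 L))
    (hR : ∀ x ∈ R, ∀ v : Fin 3 → ℂ, ∃ i j : Fin 4, i < j ∧
      ε₀ ^ 2 * (star v ⬝ᵥ v).re ≤ (star ((1 - fundamentalRep (Fin 3) (plaquetteHolonomy U x i j)) *ᵥ v) ⬝ᵥ
        ((1 - fundamentalRep (Fin 3) (plaquetteHolonomy U x i j)) *ᵥ v)).re)
    (φ : (TorusSite 4 L × Fin 3 × Fin 4) → ℂ) (hφ : ∀ p, φ p ≠ 0 → p.1 ∈ R) :
    let D := wilsonDirac (fundamentalRep (Fin 3)) U m 1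
    (m + ε₀ ^ 2 / 48) * (star φ ⬝ᵥ φ).re ≤ (star φ ⬝ᵥ (D *ᵥ φ)).re := by
  sorry

/-! ### Refutation criterion found while hunting (for the disprover; NOT a card) -/

/-- **Quasinormality-ratio criterion.** If for every pair of constants `Cs, Cw > 0` there is a torus,
a block side `b ≥ 2` and a gauge field `U` such that, for the MASSLESS Wilson–Dirac operator
(`m = 0` lies in every resolution window), (i) every non-zero vector `w` has
`b² (‖D w‖² + ‖Dᴴ w‖²) > 2 Cs² ‖w‖²` (i.e. `λ_min(DᴴD + DDᴴ) > 2Cs²/b²`) while (ii) some `ψ ≠ 0` has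
`Cw² b² ‖D ψ‖² < ‖ψ‖²` (i.e. `λ_min(DᴴD) < 1/(Cw b)²`), then `AdaptiveCoarseSystem` is FALSE.
Proof (paper, 6 lines): clauses (b)+(e) and `IsAdaptiveCoarseSystem.conjTranspose_smooth` give
`b²(‖Dg‖² + ‖Dᴴg‖²) ≤ 2Cs²‖g‖²` for every generator, so by (i) every generator vanishes, and by the
Riesz lower bound (d) `gens = ∅`; then (f) applied to `ψ` contradicts (ii). Candidate family for the
hypothesis: dislocation crystals of density `ν` (expected `λ_min(DᴴD+DDᴴ) ≳ ν`, `λ_min(DᴴD) ≲ ν²`;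
kit j007313). -/
theorem not_adaptiveCoarseSystem_of_quasinormality_ratio
    (h : ∀ Cs Cw : ℝ, 0 < Cs → 0 < Cw → ∃ (L b : ℕ) (_ : NeZero L)
      (U : GaugeConfig 4 L (Matrix.specialUnitaryGroup (Fin 3) ℂ)), 2 ≤ b ∧
      let D := wilsonDirac (fundamentalRep (Fin 3)) U 0 1
      (∀ w : (TorusSite 4 L × Fin 3 × Fin 4) → ℂ, w ≠ 0 →
        2 * Cs ^ 2 * (star w ⬝ᵥ w).re <
          (b : ℝ) ^ 2 * ((star (D *ᵥ w) ⬝ᵥ (D *ᵥ w)).re + (star (Dᴴ *ᵥ w) ⬝ᵥ (Dᴴ *ᵥ w)).re)) ∧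
      (∃ ψ : (TorusSite 4 L × Fin 3 × Fin 4) → ℂ, ψ ≠ 0 ∧
        Cw ^ 2 * (b : ℝ) ^ 2 * (star (D *ᵥ ψ) ⬝ᵥ (D *ᵥ ψ)).re < (star ψ ⬝ᵥ ψ).re)) :
    ¬ Summit.QuantumFields.QCD.Theses.AdaptiveBlockFermions.AdaptiveCoarseSystem := by
  sorry

end Summit.QuantumFields.QCD.Cruxes.AdaptiveCoarseSystem.Sketch
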